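import Summits.BirchSwinnertonDyer.BirchSwinnertonDyer.Theorems.PrintCf2RamifiedOffTYZGenusKernelFormOdd
import Summits.BirchSwinnertonDyer.Rank1Residual.WAll.AltClosersCMTwoRamifiedFamilies
import Literature.NumberTheory.QuadraticFields.RedeiReichardtFourRank
import Literature.NumberTheory.EllipticCurves.CongruentNumberOddMonskySelmerExact
import Literature.NumberTheory.EllipticCurves.CongruentNumberMonskySelmerParitySelmer
import HarnessLib

/-!
# Route `PrintCf2`, leaf `WAllCornerFTwoRamifiedTYZProved` (item 20508, CLOSED) — THE LI–LIU–TIAN FAMILY AND TIAN'S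
# CLASS 5 ARE TYZρ MEMBERS: the flag-free TYZ leaf closes WITHOUT Li–Liu–Tian 2024 Thm 1.2 (conjunct 8 of `𝔅_ram` idle)
# (cell `bsd-print-cf2`, seat p2 «2-descent matrix road», g4; file 4)

HONEST FRAMING (cell `bsd-print-cf2`, HOME `run/shared/lean/pub/bsd-print-cf2/`): THEOREMS ONLY — no definition, no
named fact, nothing asserted, nothing booked, no count moved. The flag-free TYZ family `CongruentTYZProvedFamily`
(LLT ∨ T5 ∨ T7 ∨ M35 ∨ TYZρ; leaf `WAllCornerFTwoRamifiedTYZProved`, item 20508 CLOSED by p1's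
`WAll.PrintCf2.wAllCornerFTwoRamifiedTYZProved_of_facts (h12) (h13) (hR) (hLLT) (h515) (hGZK)`) closes its LLT and T5
disjuncts through Li–Liu–Tian 2024 Thm 1.2 (`hLLT`, FULL BSD), whose `2`-part is — per the cell's DOSSIER §2.3
(⚠ PROVENANCE) — a ONE-SENTENCE verification in print ("one can also check that the 2-part of BSD holds by noting that
dim Sel₂/Im(tors) = 1"). THIS FILE removes that dependence for `BSD(E,2)`:

* §1 `tyzRho_data_of_caseFive` — for distinct primes `p₀,…,p_k ≡ 1 (mod 4)` with `n = ∏ pᵢ ≡ 5 (mod 8)` and ODD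
  Legendre graph (`hG`, kernel form), the three TYZρ membership data hold: `#Sel₂(E_n) = 8` (tree, Tian's (5.1) in
  Monsky's currency: `Tian2014.monskySelmerRankOdd_caseFive` + Monsky's formula), **`ρ(n) = 0`** (the kernel
  `{0, (𝟙;𝟙)}` has the torsion shape; `rhoIndex_eq_one_of_monskyKernel_odd`) and **`Σ₁(n)` ODD** (file 3
  `genusSum₁_eq_of_kerShape_zero_five`: `Σ₁ ≡ z·𝟙 = #{pᵢ ≡ 5 (8)} ≡ 1`, resting on Smith 2016 Thm 2.2 row 5a, a tree
  theorem). So **T5 ⊆ TYZρ**: `cornerFTwo_tianClassFive_of_tyz (h12) (hGZK)` — BSD(W, 2) on T5 modulo TYZ Thm 1.2 AS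
  PRINTED + GZK only.
* §2 `oddGraph_of_noIdealClassOfOrderFour` — for `n = ∏ pᵢ ≡ 5 (8)`, all `pᵢ ≡ 1 (4)`: «`ℚ(√−n)` has no ideal class
  of order `4`» ⟹ the Legendre graph is odd. Rédei–Reichardt is a THEOREM of the tree
  (`redeiReichardt_fourTwoCard_classGroup_holds`): an ideal class of order `4` is a square root of a non-trivial
  element of `Cl² ∩ Cl[2]`, so the hypothesis forces `#(Cl² ∩ Cl[2]) = 1`, i.e. `#ker RM(−4n) = 2`; and
  `RM(−4n) = (1 cᵀ; 0 A)` on `(2; p₀,…,p_k)` (tree `Tian2014.redeiMatrix_four_mulVec`) embeds `ker A ↪ ker RM(−4n)`.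
  Hence **LLT ⊆ T5 ⊆ TYZρ**: `cornerFTwo_congruentFamilyLLT_of_tyz (h12) (hGZK)` — BSD(W, 2) on the whole
  Li–Liu–Tian family modulo TYZ Thm 1.2 AS PRINTED + GZK, by 2-descent + genus theory, NOT by LLT's sentence.
* §3 `wAllCornerFTwoRamifiedTYZProved_of_facts_noLLT (h12) (h13) (h515) (hGZK)` — the leaf of item 20508 modulo
  FOUR conjuncts of `𝔅_ram` (1 GZK, 5 TYZ Thm 1.2′, 6 Tian Thm 1.3, 9 Monsky Cor 5.15; Rédei–Reichardt discharged):
  conjunct 8 (`LiLiuTian2024.thm12_bsd_congruentNumberCurve`) is IDLE for the flag-free TYZ leaf.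
Numerics (seat folder kit/scanT1, n < 2·10⁵): all 6 744 LLT members have `s = 1`, `ρ = 0`, `Σ₁` odd, `Σ₂′` odd — the
theorem §2 explains the first three. Beyond print: YES (an independent kernel route to BSD(E_n, 2) on the LLT family:
TYZ 2017 Thm 1.2 + 2-descent + Smith's row 5a + Rédei–Reichardt; LLT's own 2-part claim is not used).
PARTITION: 0 cells moved (item 20508 is closed); hypothesis hygiene: the TYZProved leaf's fact cone shrinks by one
named fact.

## References

* [LiLiuTian2024] Y. Li, Y. Liu, Y. Tian, Sci. Sinica Math. 54 (2024) = arXiv:1605.01481, Thm. 1.2 and p. 1 L56–62.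
* [TianYuanZhang2017] Y. Tian, X. Yuan, S.-W. Zhang, Asian J. Math. 21 (2017), Thm. 1.2, Cor. 1.4 (`A₀(n)`), §1 (ρ(n)).
* [Tian2014] Y. Tian, Camb. J. Math. 2 (2014), Lemma 5.1, Lemma 5.3 / (5.1).
* [LiMa2008] Y. Li, L. Ma, Acta Arith. 134 (2008), Thm. 0.4 (Rédei–Reichardt).
* [Smith2016CongruentDensity] A. Smith, arXiv:1603.08479, Thm. 2.2 row 5a.
* [HeathBrown1994SelmerCongruentII] D. R. Heath-Brown, Invent. Math. 118 (1994), Appendix (Monsky), typescript p. 39.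
-/

noncomputable section

open scoped Classical

open Matrix Finset WeierstrassCurve NumberField
open Literature.NumberTheory.EllipticCurves
open Literature.NumberTheory.EllipticCurves.Rank1Residual
open Literature.NumberTheory.EllipticCurves.HeathBrown1994
open Literature.NumberTheory.EllipticCurves.TianYuanZhang2017
open Literature.NumberTheory.EllipticCurves.TianYuanZhang2017.RhoMonskyKernel
open Literature.NumberTheory.EllipticCurves.LiLiuTian2024
open Literature.NumberTheory.QuadraticFields.RedeiReichardt
open Summit.BirchSwinnertonDyer Summit.BirchSwinnertonDyer.Rank1Residual

set_option autoImplicit false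

namespace Summit.BirchSwinnertonDyer.PrintCf2

variable {k : ℕ} (p : Fin (k + 1) → ℕ)

/-! ## §1 Tian's class-5 graph family carries the TYZρ data: `#Sel₂ = 8`, `ρ = 0`, `Σ₁` odd -/

/-- **T5 ⟹ TYZρ data.** For distinct primes `p₀,…,p_k ≡ 1 (mod 4)` with `∏ pᵢ ≡ 5 (mod 8)` and odd Legendre graph:
`#Sel₂(E_n) = 8`, `[E_n(ℚ) : φ_n(A_n(ℚ)) + E_n[2]] = 1` (`ρ(n) = 0`) and `Σ₁(n)` odd (over `K_d = GenusField d`). Kernel of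
Monsky's matrix `= {0, (𝟙;𝟙)}` (tree); `Σ₁ ≡ z·𝟙 = 1` by file 3. [cite: Tian2014, Lemma 5.3 and (5.1)]
[cite: TianYuanZhang2017, §1 (ρ(n)) and Thm. 1.2 (Σ₁)] [cite: Smith2016CongruentDensity, Thm. 2.2 row 5a]
[cite: HeathBrown1994SelmerCongruentII, Appendix (Monsky), typescript p. 39 L27–L33] -/
theorem tyzRho_data_of_caseFive (hp : ∀ i, (p i).Prime) (hinj : Function.Injective p)
    (h4 : ∀ i, p i % 4 = 1) (h5 : (∏ i, p i) % 8 = 5)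
    (hG : ∀ v, legendreMatrix p *ᵥ v = 0 → v = 0 ∨ v = fun _ => 1) :
    haveI := isElliptic_congruentNumberCurve (squarefree_prod_of_injective p hp hinj).ne_zero
    Nat.card ((congruentNumberCurve (∏ i, p i)).selmerGroup 2) = 8 ∧
      (rhoSubgroup (∏ i, p i)).index = 1 ∧
      Odd (genusSum₁ (∏ i, p i) fun d => genusClassNumber (GenusField d)) := by
  have hodd : ∀ i, Odd (p i) := Tian2014.odd_of_mod_four p h4
  have hp2 : ∀ i, p i ≠ 2 := fun i h => by have := h4 i; omega
  have hiff := Tian2014.monskyMatrixOdd_mulVec_eq_zero_iff_caseFive p h4 h5 hG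
  have hker := Tian2014.card_ker_monskyMatrixOdd_caseFive p h4 h5 hG
  refine ⟨?_, ?_, ?_⟩
  · rw [monsky_card_selmerGroup_two_odd_holds (k + 1) p hp hodd hinj,
      Tian2014.monskySelmerRankOdd_caseFive p h4 h5 hG]
    norm_num
  · refine rhoIndex_eq_one_of_monskyKernel_odd hp hp2 hinj (fun x y hxy => ?_) rfl
    left
    rcases (hiff _).mp hxy with h | h
    · have hx : x = 0 := funext fun i => congr_fun h (Sum.inl i)
      have hy : y = 0 := funext fun i => congr_fun h (Sum.inr i)
      rw [hx, hy, add_zero]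
    · have hx : x = fun _ => 1 := funext fun i => congr_fun h (Sum.inl i)
      have hy : y = fun _ => 1 := funext fun i => congr_fun h (Sum.inr i)
      rw [hx, hy]
      funext i
      exact CharTwo.add_self_eq_zero (1 : ZMod 2)
  · -- `Σ₁ ≡ z · 𝟙 = #{pᵢ ≡ 5 (8)} = 1`
    have hv : monskyMatrixOdd p *ᵥ Sum.elim (fun _ => (1 : ZMod 2)) (fun _ => 1) = 0 :=
      (hiff _).mpr (Or.inr (funext fun i => by cases i <;> rfl))
    have hne : Sum.elim (fun _ => (1 : ZMod 2)) (fun _ => (1 : ZMod 2)) ≠ (0 : Fin (k + 1) ⊕ Fin (k + 1) → ZMod 2) :=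
      fun h => one_ne_zero (congr_fun h (Sum.inl 0))
    have h := genusSum₁_eq_of_kerShape_zero_five p hp hodd hinj h5 hker hv hne
    rw [show (fun i => addLegendreSym 2 (p i)) ⬝ᵥ (fun _ => (1 : ZMod 2)) = ∑ i, addLegendreSym 2 (p i) by
      simp [dotProduct], Tian2014.sum_addLegendreSym_two_eq_one p h4 h5] at h
    exact ZMod.natCast_eq_one_iff_odd.mp h

/-- **SLICE T5 WITHOUT Li–Liu–Tian.** Every globally minimal model of `E_n`, `n = p₀⋯p_k ≡ 5 (8)`, all `pᵢ ≡ 1 (4)`,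
odd Legendre graph, satisfies `BSD(W, 2)` — modulo TYZ 2017 Thm 1.2 AS PRINTED (`h12`) and GZK (`hGZK`) only, through the
TYZρ door (`WAll.PrintCf2.cornerFTwo_tyzGenusRho`). Same signature as p1's `cornerFTwo_tianClassFive (hLLT) (hR)`.
[cite: TianYuanZhang2017, Thm. 1.2 and §1 (ρ(n))] [cite: Tian2014, Lemma 5.3] [cite: Miller2011LMS, Def. 1.1] -/
theorem cornerFTwo_tianClassFive_of_tyz (h12 : thm12_parity_of_scriptL')
    (hGZK : rank_eq_analyticRank_of_analyticRank_le_one) :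
    ∀ (W : WeierstrassCurve ℚ) [W.IsElliptic] [W.IsGloballyMinimal], W.HasCM → W.analyticRank = 1 →
      ∀ (k : ℕ) (p : Fin (k + 1) → ℕ), (∀ i, (p i).Prime) → Function.Injective p → (∀ i, p i % 4 = 1) →
        (∏ i, p i) % 8 = 5 → (∀ v, legendreMatrix p *ᵥ v = 0 → v = 0 ∨ v = fun _ => 1) →
        ∀ (C : VariableChange ℚ), C • congruentNumberCurve (∏ i, p i) = W → BSDp W 2 := by
  intro W _ _ hcm hr k p hp hinj h4 h5 hG C hC
  obtain ⟨hsel, hρ, hgen⟩ := tyzRho_data_of_caseFive p hp hinj h4 h5 hG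
  exact WAll.PrintCf2.cornerFTwo_tyzGenusRho h12 hGZK W hcm hr (∏ i, p i) (squarefree_prod_of_injective p hp hinj)
    (Or.inl h5) hsel hρ (Or.inl hgen) C hC

/-! ## §2 Li–Liu–Tian's class-group hypothesis forces the odd graph (Rédei–Reichardt, a tree theorem) -/

/-- In a finite abelian group with at least two squares of order dividing `2` some element has order `4`
(a square root of a non-trivial element of `Cl² ∩ Cl[2]`). [cite: Tian2014, proof of Lemma 5.1 (𝒜[4]/𝒜[2] ≃ 𝒜[2] ∩ 2𝒜)] -/
theorem exists_orderOf_eq_four_of_two_le_fourTwoCard {A : Type*} [CommGroup A] [Finite A]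
    (h : 2 ≤ Tian2014.fourTwoCard A) : ∃ c : A, orderOf c = 4 := by
  rw [Tian2014.fourTwoCard_def] at h
  haveI : Nontrivial {a : A // IsSquare a ∧ a ^ 2 = 1} := Finite.one_lt_card_iff_nontrivial.mp h
  obtain ⟨x, hx⟩ := exists_ne (⟨1, ⟨1, (mul_one 1).symm⟩, one_pow 2⟩ : {a : A // IsSquare a ∧ a ^ 2 = 1})
  obtain ⟨⟨r, hr⟩, hx2⟩ := x.2
  have hx1 : (x : A) ≠ 1 := fun h1 => hx (Subtype.ext h1)
  haveI : Fact (Nat.Prime 2) := ⟨Nat.prime_two⟩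
  refine ⟨r, ?_⟩
  have h := orderOf_eq_prime_pow (p := 2) (n := 1) (x := r) ?_ ?_
  · simpa using h
  · rw [pow_one, sq, ← hr]; exact hx1
  · rw [show 2 ^ (1 + 1) = 2 * 2 by norm_num, pow_mul, sq r, ← hr]; exact hx2

/-- **«No ideal class of order 4 in `ℚ(√−n)`» ⟹ the Legendre graph of `n` is odd**, for `n = p₀⋯p_k ≡ 5 (mod 8)` with all
`pᵢ ≡ 1 (mod 4)` — the converse of the tree's `Tian2014.noIdealClassOfOrderFour_caseFive`, with Rédei–Reichardt
DISCHARGED (`redeiReichardt_fourTwoCard_classGroup_holds`): `#(Cl² ∩ Cl[2]) = 1` for `K = GenusField n ∋ √−n`, so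
`#ker RM(−4n) = 2`, and `ξ ↦ (Σ_b [p_b ≡ 5 (8)] ξ_b ; ξ)` embeds `ker A` into `ker RM(−4n)` (`RM(−4n) = (1 cᵀ; 0 A)`).
[cite: LiMa2008, Thm. 0.4 (p. 280)] [cite: Tian2014, Lemma 5.1 (arXiv p. 28)] [cite: LiLiuTian2024, Thm. 1.2 (hypothesis)] -/
theorem oddGraph_of_noIdealClassOfOrderFour (hp : ∀ i, (p i).Prime) (hinj : Function.Injective p)
    (h4 : ∀ i, p i % 4 = 1) (h5 : (∏ i, p i) % 8 = 5)
    (hno : NoIdealClassOfOrderFour (-((∏ i, p i : ℕ) : ℤ))) :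
    ∀ v, legendreMatrix p *ᵥ v = 0 → v = 0 ∨ v = fun _ => 1 := by
  set n := ∏ i, p i with hn
  have hn4 : n % 4 = 1 := by omega
  have hn1 : 1 ≤ n := by omega
  obtain ⟨hq, hqinj, hprod⟩ := Tian2014.redei_side_conditions_cons_two p hp hinj h4 hn.symm hn4
  -- Rédei–Reichardt at `K = GenusField n`: `#(Cl² ∩ Cl[2]) = 1`
  have hK := isQuadraticFieldOfSqrt_genusField hn1
  have hft : Tian2014.fourTwoCard (ClassGroup (𝓞 (GenusField n))) = 1 := by
    have hpos : 0 < Tian2014.fourTwoCard (ClassGroup (𝓞 (GenusField n))) := by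
      rw [Tian2014.fourTwoCard_def]
      haveI : Nonempty {a : ClassGroup (𝓞 (GenusField n)) // IsSquare a ∧ a ^ 2 = 1} :=
        ⟨⟨1, ⟨1, (mul_one 1).symm⟩, one_pow 2⟩⟩
      exact Nat.card_pos
    by_contra hne
    have h2 : 2 ≤ Tian2014.fourTwoCard (ClassGroup (𝓞 (GenusField n))) := by omega
    obtain ⟨c, hc⟩ := exists_orderOf_eq_four_of_two_le_fourTwoCard h2
    exact hno (GenusField n) hK.1 hK.2 c hc
  have hkerRM : Fintype.card {x : Fin (k + 1 + 1) → ZMod 2 // redeiMatrix n (Fin.cons 2 p) *ᵥ x = 0} = 2 := by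
    rw [card_ker_redeiMatrix_eq_two_mul_fourTwoCard redeiReichardt_fourTwoCard_classGroup_holds hq hqinj hprod
      (GenusField n) hK, hft]
  -- embed `ker A` into `ker RM(−4n)`
  have hrow := Tian2014.redeiMatrix_four_mulVec p hp hinj h4 hn4
  have hc := Tian2014.sum_ite_five_eq_one p h4 h5
  have hemb : ∀ ξ : Fin (k + 1) → ZMod 2, legendreMatrix p *ᵥ ξ = 0 →
      redeiMatrix n (Fin.cons 2 p) *ᵥ
        (Fin.cons (∑ b, (if p b % 8 = 5 then (1 : ZMod 2) else 0) * ξ b) ξ) = 0 := by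
    intro ξ hξ
    funext i
    rw [hrow, Pi.zero_apply]
    refine Fin.cases ?_ (fun a => ?_) i
    · rw [Fin.cases_zero]
      simp only [Fin.cons_zero, Fin.cons_succ, mul_add, Finset.sum_add_distrib, ← Finset.sum_mul, hc, one_mul]
      exact CharTwo.add_self_eq_zero _
    · rw [Fin.cases_succ]
      have : (Fin.cons (∑ b, (if p b % 8 = 5 then (1 : ZMod 2) else 0) * ξ b) ξ : Fin (k + 1 + 1) → ZMod 2) ∘
          Fin.succ = ξ := funext fun b => by simp [Fin.cons_succ]
      rw [this, hξ, Pi.zero_apply]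
  intro v hv
  by_contra hcon
  have hv0 : v ≠ 0 := fun h => hcon (Or.inl h)
  have hv1 : v ≠ fun _ => 1 := fun h => hcon (Or.inr h)
  -- three distinct kernel vectors of `RM(−4n)`: `0`, `𝟙`, and the image of `v`
  set xv : Fin (k + 1 + 1) → ZMod 2 := Fin.cons (∑ b, (if p b % 8 = 5 then (1 : ZMod 2) else 0) * v b) v
    with hxv
  have hx0 : xv ≠ 0 := by
    intro h
    apply hv0
    funext b
    have := congr_fun h b.succ
    rw [hxv, Fin.cons_succ] at this
    exact this
  have hx1 : xv ≠ fun _ => 1 := by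
    intro h
    apply hv1
    funext b
    have := congr_fun h b.succ
    rw [hxv, Fin.cons_succ] at this
    exact this
  have h01 : (0 : Fin (k + 1 + 1) → ZMod 2) ≠ fun _ => 1 := fun h => zero_ne_one (congr_fun h 0)
  have hlt : 2 < Fintype.card {x : Fin (k + 1 + 1) → ZMod 2 // redeiMatrix n (Fin.cons 2 p) *ᵥ x = 0} := by
    rw [Fintype.two_lt_card_iff]
    exact ⟨⟨0, mulVec_zero _⟩, ⟨fun _ => 1, redeiMatrix_mulVec_one _ _⟩, ⟨xv, hemb v hv⟩,
      fun h => h01 (congrArg Subtype.val h), fun h => hx0 (congrArg Subtype.val h).symm,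
      fun h => hx1 (congrArg Subtype.val h).symm⟩
  omega

/-- **SLICE LLT WITHOUT Li–Liu–Tian.** Every globally minimal model `W` of `E_n` with `n` square-free, `n ≡ 5 (8)`, all
prime factors `≡ 1 (4)` and no ideal class of order `4` in `ℚ(√−n)` — the printed hypotheses of Li–Liu–Tian 2024
Thm 1.2 (`P2.CongruentFamilyLLT`) — satisfies `BSD(W, 2)` modulo TYZ 2017 Thm 1.2 AS PRINTED (`h12`) and GZK (`hGZK`)
ONLY: LLT ⊆ T5 (§2) ⊆ TYZρ (§1). Compare p1's `cornerFTwo_congruentFamilyLLT (hLLT)`.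
[cite: LiLiuTian2024, Thm. 1.2 (hypotheses; arXiv:1605.01481 p. 1)] [cite: TianYuanZhang2017, Thm. 1.2 and Cor. 1.4]
[cite: LiMa2008, Thm. 0.4] [cite: Miller2011LMS, Def. 1.1] -/
theorem cornerFTwo_congruentFamilyLLT_of_tyz (h12 : thm12_parity_of_scriptL')
    (hGZK : rank_eq_analyticRank_of_analyticRank_le_one) :
    ∀ (W : WeierstrassCurve ℚ) [W.IsElliptic] [W.IsGloballyMinimal], W.HasCM → W.analyticRank = 1 →
      P2.CongruentFamilyLLT W → BSDp W 2 := by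
  intro W _ _ hcm hr hW
  obtain ⟨n, hsq, h8, hfac, hno, C, hC⟩ := hW
  have hnodd : Odd n := Nat.odd_iff.mpr (by omega)
  obtain ⟨k, p, hp, hp2, hinj, hprod⟩ := MonskySelmerParity.exists_odd_prime_family_of_squarefree hsq hnodd
  cases k with
  | zero =>
    exfalso
    rw [Fin.prod_univ_zero] at hprod
    omega
  | succ k =>
    subst hprod
    have h4 : ∀ i, p i % 4 = 1 := fun i =>
      hfac (p i) (hp i) (Finset.dvd_prod_of_mem p (Finset.mem_univ i))
    have hG := oddGraph_of_noIdealClassOfOrderFour p hp hinj h4 h8 hno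
    exact cornerFTwo_tianClassFive_of_tyz h12 hGZK W hcm hr k p hp hinj h4 h8 hG C hC

/-! ## §3 The flag-free TYZ leaf without conjunct 8 (Li–Liu–Tian 2024 Thm 1.2) -/

/-- **CLOSER of the leaf `WAllCornerFTwoRamifiedTYZProved` modulo FOUR named facts** — TYZ 2017 Thm 1.2 AS PRINTED
(`h12`), Tian 2014 Thm 1.3 (`h13`, T7 only), Monsky 1990 Cor 5.15 (2) (`h515`, M35 only), GZK (`hGZK`); Rédei–Reichardt
is discharged by the tree (`redeiReichardt_fourTwoCard_classGroup_holds`) and Li–Liu–Tian 2024 Thm 1.2 is NOT used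
(p1's closer `wAllCornerFTwoRamifiedTYZProved_of_facts` takes six). Case split on the five-way membership; LLT and T5
via the TYZρ door. [cite: TianYuanZhang2017, Thm. 1.2] [cite: Tian2014, Thm. 1.3] [cite: Monsky1990MockHeegner, Cor. 5.15 (2)]
[cite: LiMa2008, Thm. 0.4] [cite: Miller2011LMS, Def. 1.1] -/
theorem wAllCornerFTwoRamifiedTYZProved_of_facts_noLLT (h12 : thm12_parity_of_scriptL')
    (h13 : Tian2014.thm13_rank_one_and_sha_odd) (h515 : Monsky1990.cor515_rank_eq_one_and_card_selmerGroup_two)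
    (hGZK : rank_eq_analyticRank_of_analyticRank_le_one) : WAllCornerFTwoRamifiedTYZProved := by
  have hR : redeiReichardt_fourTwoCard_classGroup := redeiReichardt_fourTwoCard_classGroup_holds
  intro W _ _ hcm hr _ hmem
  rcases hmem with hW | ⟨k, p, hp, hinj, h4, h5, hG, C, hC⟩ | ⟨k, p, hp, hinj, h7, h1, hG, C, hC⟩ |
      ⟨p, q, hp, hq, hp3, hq5, C, hC⟩ | ⟨n, hsq, h8, hsel, hρ, hgen, C, hC⟩
  · exact cornerFTwo_congruentFamilyLLT_of_tyz h12 hGZK W hcm hr hW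
  · exact cornerFTwo_tianClassFive_of_tyz h12 hGZK W hcm hr k p hp hinj h4 h5 hG C hC
  · exact WAll.PrintCf2.cornerFTwo_tianClassSeven h12 h13 hR W hcm hr k p hp hinj h7 h1 hG C hC
  · exact WAll.PrintCf2.cornerFTwo_threeFive h12 hR h515 W hcm hr p q hp hq hp3 hq5 C hC
  · exact WAll.PrintCf2.cornerFTwo_tyzGenusRho h12 hGZK W hcm hr n hsq h8 hsel hρ hgen C hC

end Summit.BirchSwinnertonDyer.PrintCf2

end
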